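import Summits.AtomisticToContinuum.HydrodynamicLimit.Theses.LindebergRandomFuture
import Summits.AtomisticToContinuum.HydrodynamicLimit.Theorems.LambertianContactSwapLambertianEulerOfHearts
import Summits.AtomisticToContinuum.HydrodynamicLimit.Theses.LambertianContactSwap
import Summits.AtomisticToContinuum.HydrodynamicLimit.Theorems.LambertianContactSwapLambertianEulerArchimedes
import Summits.AtomisticToContinuum.HydrodynamicLimit.Theorems.LambertianContactSwapLambertianEulerLambertLaw
import Summits.AtomisticToContinuum.HydrodynamicLimit.Theorems.LambertianContactSwapLambertianEulerPovzner
import Summits.AtomisticToContinuum.HydrodynamicLimit.Theorems.LambertianContactSwapLambertianEulerPairPovzner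
import Summits.AtomisticToContinuum.HydrodynamicLimit.Theorems.LambertianContactSwapLambertianEulerContactIsotropy
import Summits.AtomisticToContinuum.HydrodynamicLimit.Theorems.LambertianContactSwapLambertianEulerMomentLedgerChain
import Summits.AtomisticToContinuum.HydrodynamicLimit.Theorems.LambertianContactSwapLambertianEulerGibbsInvariance
import Summits.AtomisticToContinuum.HydrodynamicLimit.Theorems.LambertianContactSwapLambertianEulerEntropyToHydro
import Summits.AtomisticToContinuum.HydrodynamicLimit.Theorems.LambertianContactSwapLambertianEulerWindow
import Summits.AtomisticToContinuum.HydrodynamicLimit.Theorems.LambertianContactSwapLambertianEulerMarkov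
import Summits.AtomisticToContinuum.HydrodynamicLimit.Theorems.LambertianContactSwapLambertianEulerIterate
import Summits.AtomisticToContinuum.HydrodynamicLimit.Theorems.LambertianContactSwapLambertianEulerDock
import Summits.AtomisticToContinuum.HydrodynamicLimit.Theorems.LambertianContactSwapLambertianEulerKlLedger
import Summits.AtomisticToContinuum.HydrodynamicLimit.Theorems.LambertianContactSwapLambertianEulerLawSemigroup
import Summits.AtomisticToContinuum.HydrodynamicLimit.Theorems.LambertianContactSwapLambertianEulerDockRf
import Summits.AtomisticToContinuum.HydrodynamicLimit.Theorems.LambertianContactSwapLambertianEulerLambertDirMean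
import Summits.AtomisticToContinuum.HydrodynamicLimit.Theorems.LambertianContactSwapLambertianEulerPairMeanSq
import Summits.AtomisticToContinuum.HydrodynamicLimit.Theorems.LambertianContactSwapLambertianEulerPathwiseProduction
import Summits.AtomisticToContinuum.HydrodynamicLimit.Theorems.LambertianContactSwapLambertianEulerWindowLedger
import Summits.AtomisticToContinuum.HydrodynamicLimit.Theorems.LambertianContactSwapLambertianEulerCollisionCompensator
import Summits.AtomisticToContinuum.HydrodynamicLimit.Theorems.LambertianContactSwapLambertianEulerCompensatedJump
import Summits.AtomisticToContinuum.HydrodynamicLimit.Theorems.LambertianContactSwapLambertianEulerAprioriEntropyBound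
import Summits.AtomisticToContinuum.HydrodynamicLimit.Theorems.LambertianContactSwapLambertianEulerCollisionIntensity
import Summits.AtomisticToContinuum.HydrodynamicLimit.Theorems.LambertianContactSwapLambertianEulerTwoTimeLaw
import Summits.AtomisticToContinuum.HydrodynamicLimit.Theorems.LambertianContactSwapLambertianEulerCollisionBudget
import Summits.AtomisticToContinuum.HydrodynamicLimit.Theorems.LambertianContactSwapLambertianEulerExpectedWindowProductionTools
import Summits.AtomisticToContinuum.HydrodynamicLimit.Theorems.LambertianContactSwapLambertianEulerExpectedWindowProduction
import Summits.AtomisticToContinuum.HydrodynamicLimit.Theorems.LambertianContactSwapLambertianEulerProductionSplit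
import Summits.AtomisticToContinuum.HydrodynamicLimit.Theorems.TwoClocksClampedEntropyClockTimeZeroReference
import Summits.AtomisticToContinuum.HydrodynamicLimit.Theorems.TwoClocksClampedEntropyClockDiscreteEntropyGronwall
import Summits.AtomisticToContinuum.HydrodynamicLimit.Theorems.TwoClocksClampedEntropyClockKlDivLawAtLocalGibbsNeTop
import Literature.MathematicalPhysics.KineticTheory.LambertianRedrawNondegenerate
import Literature.MathematicalPhysics.KineticTheory.Hilbert6Wave0Proofs
import Literature.MathematicalPhysics.KineticTheory.HardSphereEulerLLN
import Literature.Barriers.AtomisticToContinuum.HighMomentumCutoff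
import Literature.Analysis.FluidPDE.HardSphereAlexander
import HarnessLib

/-! TTRL-lite variant V12799 of stmt-AtomisticToContinuum-11854 -/

namespace Summit.AtomisticToContinuum.HydrodynamicLimit.Theorems

open scoped BigOperators Topology ENNReal InnerProductSpace
open MeasureTheory ProbabilityTheory Filter Set InformationTheory
open Literature.MathematicalPhysics.KineticTheory
open Literature.Analysis.FluidPDE Literature.Analysis.FluidPDE.Alexander
open Summit.AtomisticToContinuum.HydrodynamicLimit.Theses.LambertianContactSwap
open Summit.AtomisticToContinuum.HydrodynamicLimit.Theorems.ClampedCurrentsDockPathwise (gSum DgSum)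

/-- **σ-uniform sup bound of the LLN limit density.** For every density profile `P` there are
`C = (2e + 1)·M` (`M = sup β`) and `σ₁ > 0` (from `exists_smallDensity`) such that
`|rhoLim P σ x| ≤ C` for all `0 < σ < σ₁` and all `x`: the series
`rhoLim P σ x = ∑_j γ_{j+1} R^{j+1} β(x)^{j+1}` is dominated termwise by the geometric majorant
`2eM θʲ` (`SmallDensity.abs_rhoLim_term_le`), so `|rhoLim| ≤ 2eM/(1-θ)`, and the smallness
condition `eθ/(1-θ) < 1/2` (`SmallDensity.phi_lt_half`) makes this `< (2e+1)M`, uniformly in `σ`.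
Pure cluster-expansion bookkeeping, no dynamics.
TTRL-lite variant V12799 of `stub_diluteSelfConsistency` (stmt-AtomisticToContinuum-11854). -/
theorem stub_diluteSelfConsistency_var12799 :
    ∀ P : DensityProfile, ∃ C σ₁ : ℝ, 0 < σ₁ ∧ ∀ σ : ℝ, 0 < σ → σ < σ₁ → ∀ x, |rhoLim P σ x| ≤ C := by
  intro P
  obtain ⟨σ₁, hσ₁, hsmall⟩ := exists_smallDensity P one_pos
  refine ⟨(2 * Real.exp 1 + 1) * P.M, σ₁, hσ₁, fun σ hσ hσσ₁ x => ?_⟩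
  have h : SmallDensity P σ := (hsmall σ hσ hσσ₁).1
  have hθ0 := h.geomRatio_nonneg
  have hθ1 := h.geomRatio_lt_one
  have hφ := h.phi_lt_half
  have hM := P.M_pos
  -- termwise geometric majorant ⇒ `|rhoLim| ≤ 2eM/(1-θ)`
  have hgeo : HasSum (fun j : ℕ => 2 * Real.exp 1 * P.M * geomRatio P σ ^ j)
      (2 * Real.exp 1 * P.M / (1 - geomRatio P σ)) := by
    rw [div_eq_mul_inv]
    exact (hasSum_geometric_of_lt_one hθ0 hθ1).mul_left _
  have h1 : |rhoLim P σ x| ≤ 2 * Real.exp 1 * P.M / (1 - geomRatio P σ) := by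
    refine (Real.norm_eq_abs _).symm.trans_le ?_
    exact tsum_of_norm_bounded hgeo fun j =>
      (Real.norm_eq_abs _).trans_le (h.abs_rhoLim_term_le j x)
  -- `2eM/(1-θ) = 2eM + 2M·(eθ/(1-θ)) < 2eM + M`
  have hne : (1 - geomRatio P σ) ≠ 0 := (sub_pos.2 hθ1).ne'
  have hkey : 2 * Real.exp 1 * P.M / (1 - geomRatio P σ) =
      2 * Real.exp 1 * P.M + 2 * P.M * (Real.exp 1 * geomRatio P σ / (1 - geomRatio P σ)) := by
    field_simp
    ring
  have h2 : 2 * Real.exp 1 * P.M / (1 - geomRatio P σ) ≤ (2 * Real.exp 1 + 1) * P.M := by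
    rw [hkey]; nlinarith
  exact h1.trans h2

end Summit.AtomisticToContinuum.HydrodynamicLimit.Theorems
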